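import Mathlib
import Summits.ResolutionOfSingularities.ResolutionOfSingularities.Theses.Descent
import Literature.AlgebraicGeometry.Resolution.DiscreteSeparableResidueLocalUniformization
import Literature.AlgebraicGeometry.Resolution.RootAdjunctionRegular
import HarnessLib

/-!
# Integral-closure layer + flat descent of the field fibre — rung 1 `DiscreteInseparableResidueLU`
# on the whole SEPARABLY GENERATED locus and on every DEFECTLESS uniformizing projection
# (lens-3 g8 sketch for crux `DescentPerfectToAll`, item stmt-ResolutionOfSingularities-0549;
# sub-line of the registered line `Lines/valuative_constant_step.lean`, successor of g7's
# `Lines/inert_projection_sketch.lean`; NOT a registered skeleton; counted 0 — nothing here proves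
# resolution of singularities in characteristic `p`; rung B stays OPEN).

RUNG 1 (verbatim from `Lines/valuative_constant_step.lean`): relative local uniformization over an
imperfect ground field `k` at a DISCRETE rank-one place `O` of `K/k` whose residues are purely
inseparable over `k` and not all in `k`.  g7 closed (on paper; critic TRIAGE-34) the NARROW cell with ONE
MONOGENIC inert layer `S[X]/(μ)` read through Dedekind–Kummer, and left the cells (a)+(b) WIDE/INFINITE
residue field and (c) `K/k` NOT separably generated, noting that a monogenic order is never regular
when `κ(O)/κ(O ∩ F)` is not simple and that "multi-generator layers have no field-fibre criterion".

LEVER (g8) — two moves, both residue-field-free.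
(1) TAKE THE WHOLE INTEGRAL CLOSURE AS THE LAYER.  Project WITHOUT prescribing residues
(`UniformizingSeparableProjection`): `F = k(x, t₂, …, t_d) ⊆ K` rational with `x` a UNIFORMIZER of `O`
(so `e(O | R) = 1` for the DVR `R := O ∩ F` of `F`) and `K/F` finite separable — a separating
transcendence basis through a uniformizer exists because `Ω_{K/k}` is spanned by the `d(x₀^m u)`,
`u` units.  The integral closure `R̃` of `R` in `K` is a FINITE `R`-module (separability; for `R`
discrete this is the fundamental equality `Σ e_w f_w = [K:F]`, i.e. NO DEFECT), `R̃ ⊆ O`,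
`R̃_{(𝔪_O ∩ R̃)} = O` and therefore the closed fibre of `R̃` at the centre of `O` is the FIELD
`κ(O)`: `(𝔪_O ∩ R̃)·R̃_{(𝔪_O ∩ R̃)} = 𝔪_O = x·O` — this is just `e = 1`.  Nothing about `κ(O)`
(narrow, wide, infinite, inseparable) is ever used: all of it sits over the residue field `κ(R)` of a
place of the RATIONAL field `F`, which is uniformized for free (`RegularCatchAlongDiscrete` from `k[x,t]`).
(2) FLAT DESCENT OF THE FIELD FIBRE (`FieldFibreDescendsRegular`, abstract commutative algebra).
`S` regular local, `S → R` local, `A` a finite `S`-algebra and a domain, `𝔫` a prime of `A ⊗_S R`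
over `𝔪_R` with `𝔫 = 𝔪_R` locally at `𝔫`.  Then for `𝔮 := 𝔫 ∩ A` the map
`A_𝔮/𝔪_S A_𝔮 → (A ⊗_S κ(R))_𝔫 = (A ⊗_S R)_𝔫 / 𝔫 =` a field is a LOCALISATION OF THE BASE CHANGE
of the field extension `κ(S) → κ(R)`: flat and local, hence faithfully flat, hence injective; a local
Artinian ring inside a field is a field, so `𝔮A_𝔮 = 𝔪_S A_𝔮` on `dim S` generators, while
`dim A_𝔮 = dim S` by going-down (`A` a domain, integral over the normal `S`): `A_𝔮` is REGULAR (never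
claimed smooth).  CATCHING (`RegularCatchAlongDiscrete` on the rational `F`, plus Noetherianity of the DVR
`R`): a regular local `S ⊆ R` of `F`, essentially of finite type over `k`, dominated by `R`, containing
`x, t` and the coefficients of the monic minimal polynomials of generators `y₁,…,y_m` of `R̃` and of a
finite generating set of `ker (R[Y] → K)`; then `A := S[y] ⊆ O` satisfies `A ⊗_S R ≅ R[y] = R̃`,
`Frac A = K`, and (2) at `𝔫 ↔ 𝔪_O ∩ R̃` gives `A_𝔮` regular at the centre of `O`:
`HasRegularModel k K O`; `RegularCatchAlongDiscrete` (g7's T3, any residue field) turns that into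
`RelLocalUniformization k K O`.
CONSEQUENCES (paper; for the critic to verify — every step is typed below and the assembly is
kernel-checked): `DiscreteSepGenLU` — EVERY discrete rank-one `O ∋ k` of a separably generated `K/k`
admits relative LU by REGULAR models, in every characteristic, with NO hypothesis on `κ(O)`; more
generally `DiscreteDefectlessLU` — it suffices that for SOME algebraically independent `s ⊆ O` with a
uniformizer in `F = k(s)` and `K/F` algebraic, `O` is a finitely generated module over `O ∩ K_s`
(`K_s` = separable closure of `F` in `K`; i.e. `K/K_s` has NO DEFECT at `O`; then the layer is
`R̃_s[c·y]` with `y` module generators of `O/O_s` rescaled by CRT to be integral).  Rung 1 is thereby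
REDUCED (kernel: `rung_iff₃`) to the cell `DefectEverywhereDiscreteLU p`: discrete places of
NON-separably-generated (geometrically non-reduced) `K/k` at which `K/K_s` has defect for EVERY
uniformizing transcendence basis — strictly inside g7's cell (c) (`defectEverywhere_sub_nonSepGen`).
Whether that cell is EMPTY (which would close rung 1 on paper) is OPEN: g8 could neither produce a
member (in all toy non-separably-generated examples `z^p = a x^p + b y^p`, … a purely inseparable residue
of degree `[K:K_s]` shows up and kills the defect) nor exclude one.
Consistency: `κ(O) = κ(R)` gives an ÉTALE chart (Kuhlmann 1999 Thm 1.8, rational discrete places);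
separable `κ(O)/κ(R)` an étale chart (Knaf–Kuhlmann 2005); inseparable gives regular-NOT-smooth exactly
as KK 2009 Thm 1.6 demands (Disproof §10 `not_smoothModelAfterFGEnlargement` honoured).  Nothing is
transported along a change of constants, a base change or a derivation quotient (Disproof §3/§4/§8,
negatives stmt-16484/19085 honoured): one field `K`, one ground field `k`, one valuation ring `O`.
Worked checks (sub-plan md): `A₁`-arc `z² = xy` reproduces the blow-up chart; g7's example (a);
the wide toy `yᵢ^p + x yᵢ = aᵢ (i ≤ 3)`, `d = 2`, `κ = k(a₁^{1/p},a₂^{1/p},a₃^{1/p})` (no monogenic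
regular order exists; `S[y₁,y₂,y₃]` is regular with parameters `x, t`); the one-t.b. defect witness
`k(x, ψ(x)^p) ⊂ k(x, ψ(x)) ⊂ k((x))` (immediate, degree `p`; fibre `k[Y]/(Y - ψ(0))^p`) showing why
finiteness over `O ∩ K_s` cannot be dropped from (1).

Sources: Kuhlmann 1999 (arXiv:math/9903097) p.5 Thm 1.8/Cor 1.9 + first paragraph (separable-residue
reduction, which inseparable/infinite residue fields escape); Knaf–Kuhlmann 2009 (arXiv:math/0702856)
p.3 (`R`-uniformizable := REGULAR centre vs smoothly), p.5 L29–31 (discrete: defectless ⟺ Nagata),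
Thm 1.6; Neukirch ANT II (8.3)–(8.5) (`L ⊗_K K_v ≅ ∏ L_w`, `Σ eᵢfᵢ = [L:K]` for `v` discrete, `L|K`
separable); Abhyankar 1959 §17 (projection + integral layer, dim 2 char 0); de Smit (ferociously
ramified `e = 1` extensions, background); Mathlib `IsIntegralClosure.finite`,
`IsRegularLocalRing.of_flat_of_isLocalHom`; tree: g7 `inert_projection_sketch.lean` (vocabulary copied
verbatim below so that signatures dedup).
-/

noncomputable section

set_option linter.dupNamespace false

open Literature.AlgebraicGeometry.Resolution Polynomial

namespace Summit.ResolutionOfSingularities.ResolutionOfSingularities.Cruxes.DescentPerfectToAll.SeparatedLayer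

/-- RUNG 1, verbatim copy of `ValuativeConstantStep.DiscreteInseparableResidueLU`. -/
def DiscreteInseparableResidueLU (p : ℕ) : Prop :=
  ∀ (k K : Type) [Field k] [CharP k p] [Field K] [Algebra k K], (⊤ : IntermediateField k K).FG →
    ∀ O : ValuationSubring K, (∀ c : k, algebraMap k K c ∈ O) → IsDiscreteValuationRing O →
      (∀ t : K, t ∈ O → ∃ (c : k) (n : ℕ), O.valuation (t ^ p ^ n - algebraMap k K c) < 1) →
      (∃ t : K, t ∈ O ∧ ∀ c : k, 1 ≤ O.valuation (t - algebraMap k K c)) →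
        RelLocalUniformization k K O

/-! ## Vocabulary (verbatim copies of `InertProjection.*`, g7) -/

/-- ONE finitely generated `k`-model of `K` inside `O`, regular at the centre of `O` (g7, verbatim). -/
def HasRegularModel (k K : Type) [Field k] [Field K] [Algebra k K] (O : ValuationSubring K) : Prop :=
  ∃ (A : Subalgebra k K) (hA : A.toSubring ≤ O.toSubring), A.FG ∧ IsFractionRing A K ∧
    IsRegularLocalRing
      (Localization.AtPrime (Ideal.comap (Subring.inclusion hA) (IsLocalRing.maximalIdeal O)))

/-- `K/k` is SEPARABLY GENERATED (g7, verbatim). -/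
def SepGen (k K : Type) [Field k] [Field K] [Algebra k K] : Prop :=
  ∃ (d : ℕ) (x : Fin d → K), IsTranscendenceBasis k x ∧
    Algebra.IsSeparable (IntermediateField.adjoin k (Set.range x)) K

/-- `K/k` separably generated AND the residue field of `O` NARROW (g7, verbatim). -/
def SepGenNarrow (k K : Type) [Field k] [Field K] [Algebra k K] (O : ValuationSubring K) : Prop :=
  ∃ (d : ℕ) (x : Fin d → K), IsTranscendenceBasis k x ∧
    Algebra.IsSeparable (IntermediateField.adjoin k (Set.range x)) K ∧
    ∃ b : Finset K, (∀ y ∈ b, y ∈ O) ∧ b.card ≤ d ∧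
      ∀ t : K, t ∈ O → ∃ q : K, q ∈ Algebra.adjoin k (b : Set K) ∧ O.valuation (t - q) < 1

/-- g7's sub-rung (verbatim): rung 1 + `SepGenNarrow`. -/
def NarrowResidueDiscreteLU (p : ℕ) : Prop :=
  ∀ (k K : Type) [Field k] [CharP k p] [Field K] [Algebra k K], (⊤ : IntermediateField k K).FG →
    ∀ O : ValuationSubring K, (∀ c : k, algebraMap k K c ∈ O) → IsDiscreteValuationRing O →
      (∀ t : K, t ∈ O → ∃ (c : k) (n : ℕ), O.valuation (t ^ p ^ n - algebraMap k K c) < 1) →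
      (∃ t : K, t ∈ O ∧ ∀ c : k, 1 ≤ O.valuation (t - algebraMap k K c)) →
      SepGenNarrow k K O →
        RelLocalUniformization k K O

/-- g7's residual cell (a)+(b) (verbatim): separably generated, residue field WIDE or INFINITE. -/
def WideOrInfiniteResidueDiscreteLU (p : ℕ) : Prop :=
  ∀ (k K : Type) [Field k] [CharP k p] [Field K] [Algebra k K], (⊤ : IntermediateField k K).FG →
    ∀ O : ValuationSubring K, (∀ c : k, algebraMap k K c ∈ O) → IsDiscreteValuationRing O →
      (∀ t : K, t ∈ O → ∃ (c : k) (n : ℕ), O.valuation (t ^ p ^ n - algebraMap k K c) < 1) →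
      (∃ t : K, t ∈ O ∧ ∀ c : k, 1 ≤ O.valuation (t - algebraMap k K c)) →
      SepGen k K → ¬ SepGenNarrow k K O →
        RelLocalUniformization k K O

/-- g7's residual cell (c) (verbatim): `K/k` NOT separably generated. -/
def NonSepGenDiscreteLU (p : ℕ) : Prop :=
  ∀ (k K : Type) [Field k] [CharP k p] [Field K] [Algebra k K], (⊤ : IntermediateField k K).FG →
    ∀ O : ValuationSubring K, (∀ c : k, algebraMap k K c ∈ O) → IsDiscreteValuationRing O →
      (∀ t : K, t ∈ O → ∃ (c : k) (n : ℕ), O.valuation (t ^ p ^ n - algebraMap k K c) < 1) →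
      (∃ t : K, t ∈ O ∧ ∀ c : k, 1 ≤ O.valuation (t - algebraMap k K c)) →
      ¬ SepGen k K →
        RelLocalUniformization k K O

/-- g7's STUB T3 (verbatim, shared): the quadratic sequence along a discrete `O` exhausts it. -/
def RegularCatchAlongDiscrete : Prop :=
  ∀ (k K : Type) [Field k] [Field K] [Algebra k K], (⊤ : IntermediateField k K).FG →
    ∀ O : ValuationSubring K, (∀ c : k, algebraMap k K c ∈ O) → IsDiscreteValuationRing O →
      HasRegularModel k K O →
      ∀ Z : Finset K, (∀ z ∈ Z, z ∈ O) →
        ∃ (A : Subalgebra k K) (hA : A.toSubring ≤ O.toSubring), A.FG ∧ IsFractionRing A K ∧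
          (∀ z ∈ Z, z ∈ A) ∧
          IsRegularLocalRing
            (Localization.AtPrime (Ideal.comap (Subring.inclusion hA) (IsLocalRing.maximalIdeal O)))

/-! ## New vocabulary (g8) -/

/-- UNIFORMIZING PROJECTION: a rational subfield `F = k(s)`, `s ⊆ O` finite algebraically independent,
`K/F` finite, and a uniformizer `x` of `O` inside `F` (`e(O | O ∩ F) = 1`).  No residue of `O` is
prescribed, no separability is asked (= g7's `IsInertProjection` minus its residue and separability
clauses). -/
def IsUnifProjection (k : Type) {K : Type} [Field k] [Field K] [Algebra k K]
    (O : ValuationSubring K) (F : IntermediateField k K) (x : K) : Prop :=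
  (∃ s : Finset K, (∀ y ∈ s, y ∈ O) ∧ AlgebraicIndependent k (fun z : (s : Set K) => (z : K)) ∧
      F = IntermediateField.adjoin k (s : Set K)) ∧
  FiniteDimensional F K ∧
  x ∈ F ∧ O.valuation x < 1 ∧ (∀ t : K, O.valuation t < 1 → O.valuation t ≤ O.valuation x)

/-- SEPARABLE uniformizing projection: additionally `K/F` separable. -/
def IsSepUnifProjection (k : Type) {K : Type} [Field k] [Field K] [Algebra k K]
    (O : ValuationSubring K) (F : IntermediateField k K) (x : K) : Prop :=
  IsUnifProjection k O F x ∧ Algebra.IsSeparable F K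

/-- DEFECTLESS uniformizing projection: additionally `O` is a finitely generated module over
`O ∩ K_s`, `K_s :=` the separable closure of `F` in `K` — said elementwise inside `K`: finitely many
`y ⊆ O` such that every `t ∈ O` is a combination `Σ cᵢ yᵢ` with `cᵢ ∈ O ∩ K_s`.  (For `O` discrete
with `e(O | O ∩ F) = 1` this is `f(O | O ∩ K_s) = [K : K_s]`: NO DEFECT in the purely inseparable
layer `K/K_s`.  Automatic when `K/F` is separable: `K_s = K`, `y = {1}`.) -/
def IsDefectlessUnifProjection (k : Type) {K : Type} [Field k] [Field K] [Algebra k K]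
    (O : ValuationSubring K) (F : IntermediateField k K) (x : K) : Prop :=
  IsUnifProjection k O F x ∧
  ∃ y : Finset K, (∀ i ∈ y, i ∈ O) ∧
    ∀ t : K, t ∈ O → ∃ c : K → K,
      (∀ i ∈ y, c i ∈ O ∧ c i ∈ separableClosure F K) ∧ t = ∑ i ∈ y, c i * i

theorem isDefectless_of_isSep {k K : Type} [Field k] [Field K] [Algebra k K]
    {O : ValuationSubring K} {F : IntermediateField k K} {x : K}
    (h : IsSepUnifProjection k O F x) : IsDefectlessUnifProjection k O F x := by
  obtain ⟨hU, hsep⟩ := h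
  refine ⟨hU, {1}, by simp [O.one_mem], fun t ht => ⟨fun _ => t, ?_, by simp⟩⟩
  intro i hi
  refine ⟨ht, ?_⟩
  haveI := hsep
  exact mem_separableClosure_iff.mpr (Algebra.IsSeparable.isSeparable F t)

/-- THE SUB-RUNG of g7/g8: rung 1 for `K/k` SEPARABLY GENERATED (narrow ∪ wide ∪ infinite residue
field).  Extra hypothesis only (`sub_rung`). -/
def SepGenDiscreteLU (p : ℕ) : Prop :=
  ∀ (k K : Type) [Field k] [CharP k p] [Field K] [Algebra k K], (⊤ : IntermediateField k K).FG →
    ∀ O : ValuationSubring K, (∀ c : k, algebraMap k K c ∈ O) → IsDiscreteValuationRing O →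
      (∀ t : K, t ∈ O → ∃ (c : k) (n : ℕ), O.valuation (t ^ p ^ n - algebraMap k K c) < 1) →
      (∃ t : K, t ∈ O ∧ ∀ c : k, 1 ≤ O.valuation (t - algebraMap k K c)) →
      SepGen k K →
        RelLocalUniformization k K O

/-- THE DEFECTLESS CELL of rung 1: some defectless uniformizing projection exists. -/
def DefectlessCellDiscreteLU (p : ℕ) : Prop :=
  ∀ (k K : Type) [Field k] [CharP k p] [Field K] [Algebra k K], (⊤ : IntermediateField k K).FG →
    ∀ O : ValuationSubring K, (∀ c : k, algebraMap k K c ∈ O) → IsDiscreteValuationRing O →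
      (∀ t : K, t ∈ O → ∃ (c : k) (n : ℕ), O.valuation (t ^ p ^ n - algebraMap k K c) < 1) →
      (∃ t : K, t ∈ O ∧ ∀ c : k, 1 ≤ O.valuation (t - algebraMap k K c)) →
      (∃ (F : IntermediateField k K) (x : K), IsDefectlessUnifProjection k O F x) →
        RelLocalUniformization k K O

/-- THE NEW RESIDUAL of rung 1 (g8): DEFECT for EVERY uniformizing projection (forces `K/k` not
separably generated, `defectEverywhere_sub_nonSepGen`).  OPEN whether this cell is empty. -/
def DefectEverywhereDiscreteLU (p : ℕ) : Prop :=
  ∀ (k K : Type) [Field k] [CharP k p] [Field K] [Algebra k K], (⊤ : IntermediateField k K).FG →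
    ∀ O : ValuationSubring K, (∀ c : k, algebraMap k K c ∈ O) → IsDiscreteValuationRing O →
      (∀ t : K, t ∈ O → ∃ (c : k) (n : ℕ), O.valuation (t ^ p ^ n - algebraMap k K c) < 1) →
      (∃ t : K, t ∈ O ∧ ∀ c : k, 1 ≤ O.valuation (t - algebraMap k K c)) →
      (¬ ∃ (F : IntermediateField k K) (x : K), IsDefectlessUnifProjection k O F x) →
        RelLocalUniformization k K O

/-- CLEAN THEOREM 1 (paper, lens-3 g8; characteristic-free, residue-field-free): relative LU by
REGULAR models at EVERY discrete rank-one `O ∋ k` of a separably generated `K/k`. -/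
def DiscreteSepGenLU : Prop :=
  ∀ (k K : Type) [Field k] [Field K] [Algebra k K], (⊤ : IntermediateField k K).FG →
    ∀ O : ValuationSubring K, (∀ c : k, algebraMap k K c ∈ O) → IsDiscreteValuationRing O →
      SepGen k K → RelLocalUniformization k K O

/-- CLEAN THEOREM 2 (paper, lens-3 g8): relative LU at every discrete rank-one `O ∋ k` of ANY
finitely generated `K/k` admitting a DEFECTLESS uniformizing projection. -/
def DiscreteDefectlessLU : Prop :=
  ∀ (k K : Type) [Field k] [Field K] [Algebra k K], (⊤ : IntermediateField k K).FG →
    ∀ O : ValuationSubring K, (∀ c : k, algebraMap k K c ∈ O) → IsDiscreteValuationRing O →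
      (∃ (F : IntermediateField k K) (x : K), IsDefectlessUnifProjection k O F x) →
        RelLocalUniformization k K O

/-! ## Pure logic: cells of rung 1 (kernel-checked) -/

theorem sepGen_of_sepGenNarrow {k K : Type} [Field k] [Field K] [Algebra k K] {O : ValuationSubring K}
    (h : SepGenNarrow k K O) : SepGen k K := by
  obtain ⟨d, x, hx, hsep, _⟩ := h
  exact ⟨d, x, hx, hsep⟩

/-- The sub-rung IS a special case of rung 1. -/
theorem sub_rung {p : ℕ} (h : DiscreteInseparableResidueLU p) : SepGenDiscreteLU p :=
  fun k K _ _ _ _ hfg O h0 hO h1 h2 _ => h k K hfg O h0 hO h1 h2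

/-- The sub-rung = g7's NARROW sub-rung ∧ g7's WIDE/INFINITE cell. -/
theorem sepGen_iff_cells {p : ℕ} :
    SepGenDiscreteLU p ↔ (NarrowResidueDiscreteLU p ∧ WideOrInfiniteResidueDiscreteLU p) :=
  ⟨fun h => ⟨fun k K _ _ _ _ hfg O h0 hO h1 h2 hn => h k K hfg O h0 hO h1 h2 (sepGen_of_sepGenNarrow hn),
            fun k K _ _ _ _ hfg O h0 hO h1 h2 hs _ => h k K hfg O h0 hO h1 h2 hs⟩,
   fun ⟨hN, hW⟩ k K _ _ _ _ hfg O h0 hO h1 h2 hs => by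
     by_cases hn : SepGenNarrow k K O
     · exact hN k K hfg O h0 hO h1 h2 hn
     · exact hW k K hfg O h0 hO h1 h2 hs hn⟩

/-- Rung 1 ↔ (separably generated sub-rung) ∧ (g7's non-separably-generated cell). -/
theorem rung_iff₂ {p : ℕ} : DiscreteInseparableResidueLU p ↔ (SepGenDiscreteLU p ∧ NonSepGenDiscreteLU p) :=
  ⟨fun h => ⟨sub_rung h, fun k K _ _ _ _ hfg O h0 hO h1 h2 _ => h k K hfg O h0 hO h1 h2⟩,
   fun ⟨hS, hN⟩ k K _ _ _ _ hfg O h0 hO h1 h2 => by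
     by_cases hs : SepGen k K
     · exact hS k K hfg O h0 hO h1 h2 hs
     · exact hN k K hfg O h0 hO h1 h2 hs⟩

/-- Rung 1 ↔ (defectless cell) ∧ (defect-everywhere cell) — the g8 decomposition. -/
theorem rung_iff₃ {p : ℕ} :
    DiscreteInseparableResidueLU p ↔ (DefectlessCellDiscreteLU p ∧ DefectEverywhereDiscreteLU p) :=
  ⟨fun h => ⟨fun k K _ _ _ _ hfg O h0 hO h1 h2 _ => h k K hfg O h0 hO h1 h2,
            fun k K _ _ _ _ hfg O h0 hO h1 h2 _ => h k K hfg O h0 hO h1 h2⟩,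
   fun ⟨hD, hE⟩ k K _ _ _ _ hfg O h0 hO h1 h2 => by
     by_cases hd : ∃ (F : IntermediateField k K) (x : K), IsDefectlessUnifProjection k O F x
     · exact hD k K hfg O h0 hO h1 h2 hd
     · exact hE k K hfg O h0 hO h1 h2 hd⟩

/-- Clean theorem 2 gives the defectless cell for every `p` (residue hypotheses unused). -/
theorem defectlessCell_of_clean (h : DiscreteDefectlessLU) (p : ℕ) : DefectlessCellDiscreteLU p :=
  fun k K _ _ _ _ hfg O h0 hO _ _ hd => h k K hfg O h0 hO hd

/-- Clean theorem 1 gives the sub-rung for every `p`. -/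
theorem sepGenDiscreteLU_of_clean (h : DiscreteSepGenLU) (p : ℕ) : SepGenDiscreteLU p :=
  fun k K _ _ _ _ hfg O h0 hO _ _ hs => h k K hfg O h0 hO hs

/-! ## Level 1 — stubs and the kernel-checked assemblies -/

/-- STUB P1 `UniformizingSeparableProjection` (M; field theory, EASIER than g7's T1 — nothing about
residues: from a separating transcendence basis `z ⊆ O ∪ O⁻¹` and `x₀` with `v(x₀) = 1` take
`x := x₀·u`, `u` a unit with `du ≠ 0` in `Ω_{K/k}` (if `dx₀ = 0`; `Ω_{K/k} ≠ 0` is spanned by the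
`d(x₀^m u)`), exchange `x` into the basis (`dx, dz_{i₂}, …` a basis of `Ω_{K/k}` ⇒ separating
basis for separably generated `K/k`), invert members of negative value): a SEPARABLE UNIFORMIZING
PROJECTION exists.  Why it might fail: only a mis-typing (`d = 0` is excluded: then `K/k` is algebraic
and no DVR `O ∋ k` exists). -/
def UniformizingSeparableProjection : Prop :=
  ∀ (k K : Type) [Field k] [Field K] [Algebra k K], (⊤ : IntermediateField k K).FG →
    ∀ O : ValuationSubring K, (∀ c : k, algebraMap k K c ∈ O) → IsDiscreteValuationRing O →
      SepGen k K → ∃ (F : IntermediateField k K) (x : K), IsSepUnifProjection k O F x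

/-- STUB P2 `DefectlessLayerModel` (M–L, THE NEW CONTENT; foreseen split = Level 2:
`IntegralLayerPrincipal` (valuation level) → catching on the rational `F` (`RegularCatchAlongDiscrete`
+ Noetherianity of `O ∩ F`) → `FieldFibreDescendsRegular` (abstract) → realization):
a DEFECTLESS UNIFORMIZING PROJECTION gives ONE regular finitely generated model of `K` inside `O`,
WHATEVER the residue field of `O`.  Why it might fail: the iso `S[y] ⊗_S R ≅ R[y]` needs the
`R[Y]`-relations of `y` to be generated by relations caught over `S` (they are: `R` Noetherian, catch
the finitely many generators' coefficients) — cheapest falsifier: a discrete place of a separably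
generated `K/k` dominating NO regular essentially-finite-type local ring (none known in any
characteristic; the wide toy and the `A₁`-arc come out exactly as predicted). -/
def DefectlessLayerModel : Prop :=
  ∀ (k K : Type) [Field k] [Field K] [Algebra k K], (⊤ : IntermediateField k K).FG →
    ∀ O : ValuationSubring K, (∀ c : k, algebraMap k K c ∈ O) → IsDiscreteValuationRing O →
    ∀ (F : IntermediateField k K) (x : K), IsDefectlessUnifProjection k O F x →
      HasRegularModel k K O

/-- ASSEMBLY of clean theorem 2 (kernel-checked, no sorry): P2 → T3 → `DiscreteDefectlessLU`. -/
theorem discreteDefectlessLU_of (h2 : DefectlessLayerModel) (h3 : RegularCatchAlongDiscrete) :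
    DiscreteDefectlessLU := by
  intro k K _ _ _ hfg O hk hO hd
  obtain ⟨F, x, hproj⟩ := hd
  have hmodel : HasRegularModel k K O := h2 k K hfg O hk hO F x hproj
  intro R hRfg hRfrac hRO
  obtain ⟨Z, hZ⟩ := hRfg
  have hZO : ∀ z ∈ Z, z ∈ O := by
    intro z hz
    have hzR : z ∈ R := by rw [← hZ]; exact Algebra.subset_adjoin hz
    exact hRO hzR
  obtain ⟨A, hA, hAfg, _hAfrac, hZA, hAreg⟩ := h3 k K hfg O hk hO hmodel Z hZO
  refine ⟨A, hA, ?_, hAfg, hAreg⟩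
  rw [← hZ]
  exact Algebra.adjoin_le (fun z hz => hZA z hz)

/-- ASSEMBLY of clean theorem 1 (kernel-checked): P1 → P2 → T3 → `DiscreteSepGenLU`. -/
theorem discreteSepGenLU_of (h1 : UniformizingSeparableProjection) (h2 : DefectlessLayerModel)
    (h3 : RegularCatchAlongDiscrete) : DiscreteSepGenLU := by
  intro k K _ _ _ hfg O hk hO hsg
  obtain ⟨F, x, hproj⟩ := h1 k K hfg O hk hO hsg
  exact discreteDefectlessLU_of h2 h3 k K hfg O hk hO ⟨F, x, isDefectless_of_isSep hproj⟩

/-- … hence the SUB-RUNG (g7's narrow cell AND its wide/infinite cell) for every `p`. -/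
theorem SepGenDiscreteLU_of {p : ℕ} (h1 : UniformizingSeparableProjection) (h2 : DefectlessLayerModel)
    (h3 : RegularCatchAlongDiscrete) : SepGenDiscreteLU p :=
  sepGenDiscreteLU_of_clean (discreteSepGenLU_of h1 h2 h3) p

theorem WideOrInfiniteResidueDiscreteLU_of {p : ℕ} (h1 : UniformizingSeparableProjection)
    (h2 : DefectlessLayerModel) (h3 : RegularCatchAlongDiscrete) : WideOrInfiniteResidueDiscreteLU p :=
  (sepGen_iff_cells.mp (SepGenDiscreteLU_of h1 h2 h3)).2

theorem NarrowResidueDiscreteLU_of {p : ℕ} (h1 : UniformizingSeparableProjection)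
    (h2 : DefectlessLayerModel) (h3 : RegularCatchAlongDiscrete) : NarrowResidueDiscreteLU p :=
  (sepGen_iff_cells.mp (SepGenDiscreteLU_of h1 h2 h3)).1

/-- The g8 residual lies INSIDE g7's cell (c): given P1, a place with defect everywhere lives on a
non-separably-generated `K/k` (kernel-checked). -/
theorem defectEverywhere_sub_nonSepGen {p : ℕ} (h1 : UniformizingSeparableProjection)
    (hN : NonSepGenDiscreteLU p) : DefectEverywhereDiscreteLU p := by
  intro k K _ _ _ _ hfg O hk hO h1' h2' hdef
  refine hN k K hfg O hk hO h1' h2' ?_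
  intro hs
  obtain ⟨F, x, hproj⟩ := h1 k K hfg O hk hO hs
  exact hdef ⟨F, x, isDefectless_of_isSep hproj⟩

/-- RUNG 1 from the two new stubs, g7's T3 and the DEFECT-EVERYWHERE cell alone (kernel-checked):
this is the g8 reduction of rung 1. -/
theorem DiscreteInseparableResidueLU_of {p : ℕ} (h2 : DefectlessLayerModel)
    (h3 : RegularCatchAlongDiscrete) (hE : DefectEverywhereDiscreteLU p) :
    DiscreteInseparableResidueLU p :=
  rung_iff₃.mpr ⟨defectlessCell_of_clean (discreteDefectlessLU_of h2 h3) p, hE⟩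

/-! ## Level 2 — the foreseen split of P2 (typed; the composition A → C → B → realization is
`Subring`/`TensorProduct`/`Localization` transport left to the prover, as in g7's Level 2) -/

/-- STUB P2A `IntegralLayerPrincipal` (M; valuation level, inside `K`).  Given a DEFECTLESS
UNIFORMIZING PROJECTION there is a finite `y ⊆ O` of elements integral over `R := F ∩ O` (monic
polynomials with coefficients in `F ∩ O`), generating `K` over `F`, such that in `B := R[y]` every
element of the centre `𝔪_O ∩ B` is `x ·`(an element of `B`) up to a unit of `B` outside the centre —
i.e. `B_{(𝔪_O ∩ B)} = O` and its maximal ideal is `x·B_{(𝔪_O ∩ B)}` (`e = 1`).  Proof on paper: `K_s/F`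
finite separable ⇒ `R̃_s :=` integral closure of the DVR `R` in `K_s` is module-finite
(`IsIntegralClosure.finite`; = no defect, Neukirch II 8.5) with `(R̃_s)_{(𝔪_O ∩ R̃_s)} = O ∩ K_s`;
the defectless clause gives module generators `y'` of `O` over `O ∩ K_s`; rescale `y'` by a CRT element
`c ∈ R̃_s`, `c ≡ 1` at `𝔪_O`, of large value at the other maximal ideals of `R̃_s`, to make `c·y'`
integral over `R`; `y :=` (generators of `R̃_s`) ∪ `c·y'`; then `R[y] ⊆ O`, `R[y]_{(𝔪_O ∩ R[y])} ⊇
(O ∩ K_s)[c y'] = O`.  No residue field is looked at. -/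
def IntegralLayerPrincipal : Prop :=
  ∀ (k K : Type) [Field k] [Field K] [Algebra k K],
    ∀ O : ValuationSubring K, IsDiscreteValuationRing O →
    ∀ (F : IntermediateField k K) (x : K), IsDefectlessUnifProjection k O F x →
      ∃ y : Finset K,
        (∀ z ∈ y, z ∈ O ∧ ∃ μ : K[X], μ.Monic ∧ (∀ i, μ.coeff i ∈ F ∧ μ.coeff i ∈ O) ∧ μ.eval z = 0) ∧
        IntermediateField.adjoin F (y : Set K) = ⊤ ∧
        ∀ b ∈ Subring.closure (((F : Set K) ∩ (O : Set K)) ∪ (y : Set K)), O.valuation b < 1 →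
          ∃ c ∈ Subring.closure (((F : Set K) ∩ (O : Set K)) ∪ (y : Set K)),
          ∃ u ∈ Subring.closure (((F : Set K) ∩ (O : Set K)) ∪ (y : Set K)),
            O.valuation u = 1 ∧ b * u = x * c

/-- STUB P2B `FieldFibreDescendsRegular` (M; Lemma B — pure commutative algebra over Mathlib: the
localised base change of the field extension `κ(S) → κ(R)` is flat and local, hence faithfully flat,
hence injective; a local Artinian subring of a field is a field; going-down for a domain integral over
an integrally closed domain; `𝔮A_𝔮 = 𝔪_S A_𝔮` on `dim S = dim A_𝔮` generators ⇒ regular).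
`S` regular local, `S → R` a local homomorphism into a local ring, `A` a finite `S`-algebra which is a
domain with `S ↪ A`; `𝔫` a prime of `A ⊗_S R` containing `𝔪_R` and EQUAL TO `𝔪_R` LOCALLY AT `𝔫`;
then `A` localised at `𝔮 := 𝔫 ∩ A` is a REGULAR local ring. -/
def FieldFibreDescendsRegular : Prop :=
  ∀ (S R A : Type) [CommRing S] [IsRegularLocalRing S] [IsDomain S] [IsIntegrallyClosed S]
    [CommRing R] [IsLocalRing R] [Algebra S R] [CommRing A] [IsDomain A] [Algebra S A]
    [Module.Finite S A],
    IsLocalHom (algebraMap S R) → Function.Injective (algebraMap S A) →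
    ∀ (𝔫 : Ideal (TensorProduct S A R)) [𝔫.IsPrime],
      (IsLocalRing.maximalIdeal R).map
          (Algebra.TensorProduct.includeRight : R →ₐ[S] TensorProduct S A R) ≤ 𝔫 →
      (∀ b ∈ 𝔫, ∃ u ∉ 𝔫, u * b ∈ (IsLocalRing.maximalIdeal R).map
          (Algebra.TensorProduct.includeRight : R →ₐ[S] TensorProduct S A R)) →
      IsRegularLocalRing (Localization.AtPrime
        (𝔫.comap (Algebra.TensorProduct.includeLeftRingHom : A →+* TensorProduct S A R)))

/-- STUB P2C (= g7's T3 applied to `(k, F, F ∩ O)` from the polynomial model `k[s]`, plus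
Noetherianity of the DVR `R = F ∩ O`): a regular local `S ⊆ R`, essentially of finite type over `k`,
dominated by `R`, containing `s`, the coefficients of the `μ`'s of P2A and of a finite generating set
of `ker (R[Y] → K)`, so that `A := S[y]` satisfies `A ⊗_S R ≅ R[y]`.  STUB P2D (realization,
bookkeeping): `A ⊆ O`, `Frac A = K` (`F(y) = K`), `A_𝔮` is the local ring of the f.g. `k`-algebra
`T[1/u][y]` at the centre of `O` (`S = T_𝔭`), and P2B's hypothesis at `𝔫 ↔ 𝔪_O ∩ R[y]` is P2A's
principality transported through `A ⊗_S R ≅ R[y]`.  Composition P2A → P2C → P2B → P2D = P2 is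
transport; left to the prover (as g7's T2b/T2d). -/
def DefectlessLayerModelSplitNote : Prop := True

/-! ## Level 3 (g8, SECOND lever, for the residual cell) — the ROOT LAYER over a regular model of
the bottom field.  A purely inseparable degree-`p` layer `z^p = w` over a regular local `S ∋ w` is
REGULAR exactly when `w` is not a `p`-th power to second order: `∀ c ∈ S, w − c^p ∉ 𝔪_S²`
(⟺ `dw ≠ 0` in `Ω_{S/𝔽_p} ⊗ κ(S)`, the ARITHMETIC differentials `dc_j`, `c_j ∈ k ∖ k^p`, included —
regular, never smooth when `w̄ ∉ κ(S)^p` or `dw` is purely arithmetic).  In the residual cell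
`K = K_s(z) ⊋ K_s ∋ w = z^p` with `w ∈ k·K_s^p` (that is what "not separably generated" means:
`dw = 0` in `Ω_{K_s/k}`), and DEFECT says `z` is an `x`-adic limit from `K_s`, i.e. `dw → 0` in the
completion — but a MODEL `S ∋ w` LOW in the quadratic tower along `O ∩ K_s` can still have
`dw(centre) ≠ 0` (worked in the sub-plan §8: the twisted arc on `z^p = a x^p + b y^p`, which HAS
defect for the basis `{x, y}`, is uniformized by the root layer over `k[x,y]` at level 0).  This is
the first lever of the lineage that USES the rung-1 hypothesis "not every residue lies in `k`":
residues outside a small `κ(S)` put the layer in the field-fibre case. -/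

/-- From ONE regular model to relative LU along a discrete `O` (the T3 tail of every assembly). -/
theorem relLU_of_model (h3 : RegularCatchAlongDiscrete) {k K : Type} [Field k] [Field K]
    [Algebra k K] (hfg : (⊤ : IntermediateField k K).FG) (O : ValuationSubring K)
    (hk : ∀ c : k, algebraMap k K c ∈ O) (hO : IsDiscreteValuationRing O)
    (hmodel : HasRegularModel k K O) : RelLocalUniformization k K O := by
  intro R hRfg hRfrac hRO
  obtain ⟨Z, hZ⟩ := hRfg
  have hZO : ∀ z ∈ Z, z ∈ O := by
    intro z hz
    have hzR : z ∈ R := by rw [← hZ]; exact Algebra.subset_adjoin hz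
    exact hRO hzR
  obtain ⟨A, hA, hAfg, _hAfrac, hZA, hAreg⟩ := h3 k K hfg O hk hO hmodel Z hZO
  refine ⟨A, hA, ?_, hAfg, hAreg⟩
  rw [← hZ]
  exact Algebra.adjoin_le (fun z hz => hZA z hz)

/-- LEMMA R `RootLayerCriterion` (folklore; Mathlib-only; the tree's
`Literature.AlgebraicGeometry.Resolution.AdjoinRoot.isRegularLocalRing_X_pow_sub_C` is the case
`w ∈ 𝔪_S ∖ 𝔪_S²`).  For a regular local ring `S` of characteristic `p` and `w ∈ S` with
`w − c^p ∉ 𝔪_S²` for every `c ∈ S`, the root layer `S[Z]/(Z^p − w)` is a regular local ring.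
Proof on paper: it is finite free over `S`, local (unique prime over `𝔪_S` since `Z^p − w̄` is a
`p`-th power or irreducible over `κ(S)`); if `w̄ ∉ κ(S)^p` the closed fibre `κ(S)[Z]/(Z^p − w̄)` is a
FIELD, so `𝔪 = 𝔪_S·B` has `dim S = dim B` generators; if `w̄ = c̄^p`, `Z ↦ Z − c` rewrites the layer
as `S[Z']/(Z'^p − (w − c^p))` with `w − c^p ∈ 𝔪_S ∖ 𝔪_S²` a regular parameter (the landed case).
The converse holds too (`w − c^p ∈ 𝔪_S²` ⇒ embedding dimension `dim S + 1`); equivalently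
`dw ≠ 0` in `Ω_{S/𝔽_p} ⊗ κ(S)` (regular rings are formally smooth over the prime field). -/
def RootLayerCriterion (p : ℕ) [Fact p.Prime] : Prop :=
  ∀ (S : Type) [CommRing S] [IsRegularLocalRing S] [CharP S p] (w : S),
    (∀ c : S, w - c ^ p ∉ (IsLocalRing.maximalIdeal S) ^ 2) →
      IsRegularLocalRing (AdjoinRoot (X ^ p - C w : S[X]))

/-- A ROOT-LAYER DATUM for `(k, K, O)`: a subfield `L` (in the application `L = K_s`, the separable
closure of a uniformizing `k(s)`), a finitely generated `A ⊆ O ∩ L` with fraction field `L` whose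
local ring `S` at the centre of `O` is REGULAR, and `z ∈ O` with `z^p ∈ A`, `L(z) = K`, such that
`z^p − c^p ∉ 𝔪_S²` for all `c ∈ S`.  (The last clause forces `z ∉ L`: `S` is normal.) -/
def HasRootLayerDatum (p : ℕ) (k K : Type) [Field k] [Field K] [Algebra k K]
    (O : ValuationSubring K) : Prop :=
  ∃ (L : IntermediateField k K) (A : Subalgebra k K) (hA : A.toSubring ≤ O.toSubring) (z : K)
    (hz : z ^ p ∈ A.toSubring),
    (∀ a : K, a ∈ A → a ∈ L) ∧ A.FG ∧
    (∀ t : K, t ∈ L → ∃ a b : K, a ∈ A ∧ b ∈ A ∧ b ≠ 0 ∧ t = a / b) ∧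
    z ∈ O ∧ IntermediateField.adjoin L ({z} : Set K) = ⊤ ∧
    IsRegularLocalRing
      (Localization.AtPrime (Ideal.comap (Subring.inclusion hA) (IsLocalRing.maximalIdeal O))) ∧
    (∀ c : Localization.AtPrime (Ideal.comap (Subring.inclusion hA) (IsLocalRing.maximalIdeal O)),
      algebraMap A.toSubring
          (Localization.AtPrime (Ideal.comap (Subring.inclusion hA) (IsLocalRing.maximalIdeal O)))
          ⟨z ^ p, hz⟩ - c ^ p ∉
        (IsLocalRing.maximalIdeal
          (Localization.AtPrime
            (Ideal.comap (Subring.inclusion hA) (IsLocalRing.maximalIdeal O)))) ^ 2)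

/-- STUB P3 `RootLayerEscape` (M; TRUE on paper from LEMMA R): a root-layer datum gives a regular
model of `K` inside `O`.  Paper: `S := A_𝔭` (𝔭 the centre), `w := z^p`; LEMMA R ⇒ `B := S[Z]/(Z^p − w)`
regular local; the clause forces `z ∉ L` (else `z ∈ S` by normality and `c = z` violates it), so
`[K : L] = p` and the free rank-`p` algebra `B` maps ISOMORPHICALLY onto `S[z] ⊆ O` (`z ∈ O`,
`S ⊆ O`); `S[z]` is local, finite over `S`, hence its unique maximal ideal is the centre of `O`; and
`S[z] = (A[z])_{centre}` with `A[z]` finitely generated, `Frac = L(z) = K`: `HasRegularModel k K O`.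
Why it might fail: only Lean transport (`AdjoinRoot ≃ S[z]`, `Localization` of `Algebra.adjoin`). -/
def RootLayerEscape (p : ℕ) : Prop :=
  ∀ (k K : Type) [Field k] [CharP k p] [Field K] [Algebra k K], (⊤ : IntermediateField k K).FG →
    ∀ O : ValuationSubring K, (∀ c : k, algebraMap k K c ∈ O) → IsDiscreteValuationRing O →
      HasRootLayerDatum p k K O → HasRegularModel k K O

/-- THE RESIDUAL after BOTH g8 levers: rung-1 places with DEFECT for every uniformizing projection
AND NO root-layer datum.  OPEN whether empty (no member known; every example of the seat escapes by
one of the two levers; sub-plan §4, §8). -/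
def DefectNoRootDiscreteLU (p : ℕ) : Prop :=
  ∀ (k K : Type) [Field k] [CharP k p] [Field K] [Algebra k K], (⊤ : IntermediateField k K).FG →
    ∀ O : ValuationSubring K, (∀ c : k, algebraMap k K c ∈ O) → IsDiscreteValuationRing O →
      (∀ t : K, t ∈ O → ∃ (c : k) (n : ℕ), O.valuation (t ^ p ^ n - algebraMap k K c) < 1) →
      (∃ t : K, t ∈ O ∧ ∀ c : k, 1 ≤ O.valuation (t - algebraMap k K c)) →
      (¬ ∃ (F : IntermediateField k K) (x : K), IsDefectlessUnifProjection k O F x) →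
      ¬ HasRootLayerDatum p k K O →
        RelLocalUniformization k K O

/-- The residual shrinks (kernel-checked): P3 + T3 + the no-root residual give the defect-everywhere
cell. -/
theorem defectEverywhere_of_rootEscape {p : ℕ} (h3 : RegularCatchAlongDiscrete)
    (hR : RootLayerEscape p) (hN : DefectNoRootDiscreteLU p) : DefectEverywhereDiscreteLU p := by
  intro k K _ _ _ _ hfg O hk hO h1 h2 hdef
  by_cases hroot : HasRootLayerDatum p k K O
  · exact relLU_of_model h3 hfg O hk hO (hR k K hfg O hk hO hroot)
  · exact hN k K hfg O hk hO h1 h2 hdef hroot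

/-- Trivially the other way: the no-root residual is a sub-cell of the defect-everywhere cell. -/
theorem defectNoRoot_of_defectEverywhere {p : ℕ} (hE : DefectEverywhereDiscreteLU p) :
    DefectNoRootDiscreteLU p :=
  fun k K _ _ _ _ hfg O hk hO h1 h2 hdef _ => hE k K hfg O hk hO h1 h2 hdef

/-- RUNG 1 from P2, T3, P3 and the NO-ROOT residual alone (kernel-checked; g8's final reduction). -/
theorem DiscreteInseparableResidueLU_of₂ {p : ℕ} (h2 : DefectlessLayerModel)
    (h3 : RegularCatchAlongDiscrete) (hR : RootLayerEscape p) (hN : DefectNoRootDiscreteLU p) :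
    DiscreteInseparableResidueLU p :=
  DiscreteInseparableResidueLU_of h2 h3 (defectEverywhere_of_rootEscape h3 hR hN)

/-- And rung 1 gives the no-root residual back (it is a restriction of rung 1). -/
theorem defectNoRoot_of_rung {p : ℕ} (h : DiscreteInseparableResidueLU p) : DefectNoRootDiscreteLU p :=
  defectNoRoot_of_defectEverywhere (rung_iff₃.mp h).2

/-! ## Level 3b (g8) — the RELATIVE root layer + THEOREM 1′.  THEOREM 1's mechanism never used
that `F` is rational except to get a regular model of `F` at `O ∩ F` for free: for ANY intermediate
field `F' ∋ x` (uniformizer of `O`) with `K/F'` finite SEPARABLE and `HasRegularModel k F' (O ∩ F')`,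
the integral closure of the DVR `O ∩ F'` in `K` is finite with field fibre at the centre, T3 catches on
`F'`, P2B descends: `HasRegularModel k K O` (THEOREM 1′, stub `RelativeLayerModel`).  Feeding it the
root layer: `F' := L(z')` where `L ⊆ K_s` is ANY subfield containing a rational uniformizing
projection `F` and `w' := z'^p`, `S` a regular model of `L` at `O ∩ L` satisfying LEMMA R's criterion
for `w'`, and `K/L(z')` separable (automatic when `K = K_s(z')`).  Smaller `L` (down to `F(w')`) =
smaller residue fields `κ(S)` = easier field-fibre case; this relaxes `HasRootLayerDatum`'s
`L(z) = K`. -/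

/-- STUB P2′ `RelativeLayerModel` (THEOREM 1′; M given P2's split: the same four steps with the
rational `F` replaced by any `F'` carrying a regular model at `O ∩ F'`): `x ∈ F'` a uniformizer of
`O`, `K/F'` finite separable, `HasRegularModel k F' (O ∩ F')` ⟹ `HasRegularModel k K O`.
Why it might fail: as P2 (nothing new: `O ∩ F'` is a DVR because `x ∈ F'`; finiteness of the
integral closure from separability; e = 1 from `v(x) = 1`). -/
def RelativeLayerModel : Prop :=
  ∀ (k K : Type) [Field k] [Field K] [Algebra k K], (⊤ : IntermediateField k K).FG →
    ∀ O : ValuationSubring K, (∀ c : k, algebraMap k K c ∈ O) → IsDiscreteValuationRing O →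
    ∀ (F' : IntermediateField k K) (x : K), x ∈ F' → O.valuation x < 1 →
      (∀ t : K, O.valuation t < 1 → O.valuation t ≤ O.valuation x) →
      FiniteDimensional F' K → Algebra.IsSeparable F' K →
      HasRegularModel k F' ((O.comap (algebraMap F' K))) →
        HasRegularModel k K O

/-- RELATIVE ROOT-LAYER DATUM at `O`: a rational uniformizing projection `F ∋ x` (so `K/F` finite),
an intermediate field `L ⊇ F`, a finitely generated `A ⊆ O ∩ L` with `Frac A = L` whose local ring
`S` at the centre of `O` is regular, and `z ∈ O` with `z^p ∈ A`, `K` SEPARABLE over `L(z)`, and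
LEMMA R's criterion for `z^p` at `S`. -/
def HasRelRootLayerDatum (p : ℕ) (k K : Type) [Field k] [Field K] [Algebra k K]
    (O : ValuationSubring K) : Prop :=
  ∃ (F L : IntermediateField k K) (x : K) (A : Subalgebra k K) (hA : A.toSubring ≤ O.toSubring)
    (z : K) (hz : z ^ p ∈ A.toSubring),
    IsUnifProjection k O F x ∧ F ≤ L ∧
    (∀ a : K, a ∈ A → a ∈ L) ∧ A.FG ∧
    (∀ t : K, t ∈ L → ∃ a b : K, a ∈ A ∧ b ∈ A ∧ b ≠ 0 ∧ t = a / b) ∧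
    z ∈ O ∧ Algebra.IsSeparable (IntermediateField.adjoin L ({z} : Set K)) K ∧
    IsRegularLocalRing
      (Localization.AtPrime (Ideal.comap (Subring.inclusion hA) (IsLocalRing.maximalIdeal O))) ∧
    (∀ c : Localization.AtPrime (Ideal.comap (Subring.inclusion hA) (IsLocalRing.maximalIdeal O)),
      algebraMap A.toSubring
          (Localization.AtPrime (Ideal.comap (Subring.inclusion hA) (IsLocalRing.maximalIdeal O)))
          ⟨z ^ p, hz⟩ - c ^ p ∉
        (IsLocalRing.maximalIdeal
          (Localization.AtPrime
            (Ideal.comap (Subring.inclusion hA) (IsLocalRing.maximalIdeal O)))) ^ 2)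

/-- STUB P3′ `RelRootLayerEscape` (M; TRUE on paper = LEMMA R + THEOREM 1′): `S[z] ≅ S[Z]/(Z^p − z^p)`
is a regular model of `F' := L(z)` at `O ∩ F'` (LEMMA R; the criterion forces `z ∉ L`, `S` being
normal), `x ∈ F'` is a uniformizer of `O`, `K/F'` finite separable — THEOREM 1′ gives
`HasRegularModel k K O`. -/
def RelRootLayerEscape (p : ℕ) : Prop :=
  ∀ (k K : Type) [Field k] [CharP k p] [Field K] [Algebra k K], (⊤ : IntermediateField k K).FG →
    ∀ O : ValuationSubring K, (∀ c : k, algebraMap k K c ∈ O) → IsDiscreteValuationRing O →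
      HasRelRootLayerDatum p k K O → HasRegularModel k K O

/-- THE RESIDUAL after ALL g8 levers: defect for every uniformizing projection, no root-layer datum,
no relative root-layer datum.  OPEN whether empty. -/
def DefectNoRootBothDiscreteLU (p : ℕ) : Prop :=
  ∀ (k K : Type) [Field k] [CharP k p] [Field K] [Algebra k K], (⊤ : IntermediateField k K).FG →
    ∀ O : ValuationSubring K, (∀ c : k, algebraMap k K c ∈ O) → IsDiscreteValuationRing O →
      (∀ t : K, t ∈ O → ∃ (c : k) (n : ℕ), O.valuation (t ^ p ^ n - algebraMap k K c) < 1) →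
      (∃ t : K, t ∈ O ∧ ∀ c : k, 1 ≤ O.valuation (t - algebraMap k K c)) →
      (¬ ∃ (F : IntermediateField k K) (x : K), IsDefectlessUnifProjection k O F x) →
      ¬ HasRootLayerDatum p k K O →
      ¬ HasRelRootLayerDatum p k K O →
        RelLocalUniformization k K O

/-- Kernel: P3′ + T3 + the both-residual give the no-root residual. -/
theorem defectNoRoot_of_relRootEscape {p : ℕ} (h3 : RegularCatchAlongDiscrete)
    (hR : RelRootLayerEscape p) (hN : DefectNoRootBothDiscreteLU p) : DefectNoRootDiscreteLU p := by
  intro k K _ _ _ _ hfg O hk hO h1 h2 hdef hroot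
  by_cases hrel : HasRelRootLayerDatum p k K O
  · exact relLU_of_model h3 hfg O hk hO (hR k K hfg O hk hO hrel)
  · exact hN k K hfg O hk hO h1 h2 hdef hroot hrel

theorem defectNoRootBoth_of_defectNoRoot {p : ℕ} (hE : DefectNoRootDiscreteLU p) :
    DefectNoRootBothDiscreteLU p :=
  fun k K _ _ _ _ hfg O hk hO h1 h2 hdef hroot _ => hE k K hfg O hk hO h1 h2 hdef hroot

/-- RUNG 1 from P2, T3, P3, P3′ and the BOTH residual (kernel-checked; g8's finest reduction). -/
theorem DiscreteInseparableResidueLU_of₃ {p : ℕ} (h2 : DefectlessLayerModel)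
    (h3 : RegularCatchAlongDiscrete) (hR : RootLayerEscape p) (hR' : RelRootLayerEscape p)
    (hN : DefectNoRootBothDiscreteLU p) : DiscreteInseparableResidueLU p :=
  DiscreteInseparableResidueLU_of₂ h2 h3 hR (defectNoRoot_of_relRootEscape h3 hR' hN)

theorem defectNoRootBoth_of_rung {p : ℕ} (h : DiscreteInseparableResidueLU p) :
    DefectNoRootBothDiscreteLU p :=
  defectNoRootBoth_of_defectNoRoot (defectNoRoot_of_rung h)

/-! ## `∀ p` closures (probe targets) -/

def SepGenDiscreteLUAll : Prop := ∀ p : ℕ, p.Prime → SepGenDiscreteLU p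
def DefectlessCellDiscreteLUAll : Prop := ∀ p : ℕ, p.Prime → DefectlessCellDiscreteLU p
def DefectEverywhereDiscreteLUAll : Prop := ∀ p : ℕ, p.Prime → DefectEverywhereDiscreteLU p
def DiscreteInseparableResidueLUAll : Prop := ∀ p : ℕ, p.Prime → DiscreteInseparableResidueLU p

theorem sepGenAll_of_rungAll (h : DiscreteInseparableResidueLUAll) : SepGenDiscreteLUAll :=
  fun p hp => sub_rung (h p hp)

theorem defectlessCellAll_of_rungAll (h : DiscreteInseparableResidueLUAll) : DefectlessCellDiscreteLUAll :=
  fun p hp => (rung_iff₃.mp (h p hp)).1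

theorem rungAll_of_stubs (h2 : DefectlessLayerModel) (h3 : RegularCatchAlongDiscrete)
    (hE : DefectEverywhereDiscreteLUAll) : DiscreteInseparableResidueLUAll :=
  fun p hp => DiscreteInseparableResidueLU_of h2 h3 (hE p hp)

def DefectNoRootDiscreteLUAll : Prop := ∀ p : ℕ, p.Prime → DefectNoRootDiscreteLU p
def RootLayerEscapeAll : Prop := ∀ p : ℕ, p.Prime → RootLayerEscape p
/-- LEMMA R for all primes (probe target; `Fact p.Prime` supplied from the binder). -/
def RootLayerCriterionAll : Prop := ∀ p : ℕ, (hp : p.Prime) → @RootLayerCriterion p ⟨hp⟩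

def DefectNoRootBothDiscreteLUAll : Prop := ∀ p : ℕ, p.Prime → DefectNoRootBothDiscreteLU p
def RelRootLayerEscapeAll : Prop := ∀ p : ℕ, p.Prime → RelRootLayerEscape p

theorem rungAll_of_stubs₂ (h2 : DefectlessLayerModel) (h3 : RegularCatchAlongDiscrete)
    (hR : RootLayerEscapeAll) (hN : DefectNoRootDiscreteLUAll) : DiscreteInseparableResidueLUAll :=
  fun p hp => DiscreteInseparableResidueLU_of₂ h2 h3 (hR p hp) (hN p hp)

theorem rungAll_of_stubs₃ (h2 : DefectlessLayerModel) (h3 : RegularCatchAlongDiscrete)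
    (hR : RootLayerEscapeAll) (hR' : RelRootLayerEscapeAll) (hN : DefectNoRootBothDiscreteLUAll) :
    DiscreteInseparableResidueLUAll :=
  fun p hp => DiscreteInseparableResidueLU_of₃ h2 h3 (hR p hp) (hR' p hp) (hN p hp)

end Summit.ResolutionOfSingularities.ResolutionOfSingularities.Cruxes.DescentPerfectToAll.SeparatedLayer

end
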